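import Summits.QuantumFields.YangMills.Theorems.UnitScaleTiltProp7DivRecoveryPatchAlphaRows
import Summits.QuantumFields.YangMills.Theorems.UnitScaleTiltProp7BoxLocalResidualMember
import Summits.QuantumFields.YangMills.Theorems.UnitScaleTiltProp7BoxLocalPotentialCutoffH1
import Summits.QuantumFields.YangMills.Theorems.UnitScaleTiltProp7DivRecoveryAssemblyBudgetW4
import Summits.QuantumFields.YangMills.Theorems.UnitScaleTiltProp7Lane2BoxPlateauCutoff
import Summits.QuantumFields.YangMills.Theorems.UnitScaleTiltProp7QkcInnerPatchRows
import Summits.QuantumFields.YangMills.Theorems.UnitScaleTiltProp7Lane2PatchCommutatorCubes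
import Summits.QuantumFields.YangMills.Theorems.UnitScaleTiltProp7TiledCubeMemberH7H8
import Summits.QuantumFields.YangMills.Theorems.UnitScaleTiltProp7DivRecoveryCurrencyH9
import HarnessLib

/-!
# Route `UnitScaleTilt`, crux K1 «MinimiserStabilityRegPr» (stmt-QuantumFields-19200), LANE II «DIVERGENCE RECOVERY AT CURVED `W`» (★★OWNER RULING №23), [I-9]
# PATCHES1 (★p1 g20 WORDS №17 (3): hand of record w1-19200 g16), (P2) «PEEL + χ»: **ONE PATCH OF THE MEMBER — EVERY PER-PATCH ROW BUT h7∕h8, BY NAME**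

Cell `ym3-torus` (HUMAN RULING D-0037, YM ladder rung R3 — YM₃ on T³ is a rung, NOT d = 4, NOT infinite volume, NOT a mass gap, NOT Clay; YM gap NOT proved), width seat
`ym-ust-19200-w1` (gen 16).  THEOREMS ONLY (0 `def`, 0 `sorry`); `--supports stmt-QuantumFields-19200 --as helper`; count-neutral.

WHAT IS PROVED.  ★★★`patch_rows_core`: for one patch of the regular member — corner centre `c` of the coarse block `C` (`c κ = C.val·ℓ`), base chart `basePt`, record box
`(z, R) = (z_c, R_f)` (px9's letters, passed as the two defining equations `hz hRdef`), pull-back `V` with its plaquette datum and the two (B8) windows, the one-form `y`,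
w4's curl reading `hCurl` (letter `Cu`), the FAMILY cutoff `(Z, ζ, ZE)` of the patch with ✓`exists_cutoffPackage_grid`'s per-centre rows VERBATIM (`h01 hsuppζ hstepζ hsecζ hZ hZE`),
the energy bond set `T ⊇` inside-chart bonds, a coarse-bond set `S` inside the box-plateau margin (`hSC`, px9 6c ▸ ✓`Prop7Lane2BoxPlateauPeel`), the (QH1)♮ row at this member
(`hQ`, an EX-displayed hypothesis, door functional written out), ✓`coarseGrad_rows_on_inner` at this member (`hrow9`, its `C3` chosen upstream) and the transition-cube
mass domination `hboxS` (px9's peeled box mass) — THERE EXIST the patch potentials `φ κs r φ_Z` ((B8-member) ✓`boxLocalResidual_member`) with: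
(S1b), (0) (pass-through for px9's ✓`h7h8_member_peeled`) · `hloc`∕`hDφ` in `Z`-form (✓`patch_alpha_rows`) · h1 `Gφ_in ≤ N_T` · h2 `‖φ‖² ≤ 576L^{2s}N_T` ·
h3 `‖Z κs‖² ≤ 13824A²L^{2s}e²‖r‖²` · h4 `‖r‖² ≤ 1944Cc·L^{2s}Cu + 20155392A²L^{4s}e²N_T` · h5∕h6∕h11 (px11 ✓`norm_sq_lapComm_le_of_le`∕`norm_sq_gradComm_le_of_le`∕
`localEnergy_gradComm_le_of_le` on the cyclic cubes of radius `L^sℓ + 2`, `+ 4`; local gradient energy paid by `Gφ_in ≤ N_T` via ✓`localGrad_le_chartEnergy`) ·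
h10 `H(ZE r) ≤ (24 + 432A² + 108)(Cu_W + e²‖φ‖² + K + L^{−2s}‖r‖²)` (w5 ✓`cutoffH1_member` ▸ ✓`currency_h10`) · h9 IN BUDGET CURRENCY
`Gc ≤ 4As + B·ρ + BC·Cu_W + BK·K + Ct·e²Φ` through the BOX-PLATEAU CUTOFF `χ` of ✓`Prop7Lane2BoxPlateauCutoff` (`exists_boxPlateauCutoff` ▸ ✓`patch_hDφ` at `Zχb` ▸
✓`cutoffH1_member` at `χ` (`δ = 2∕ℓ`, `Cδ = 2L^s`) ▸ ✓`currency_h10` ▸ `hrow9` at `χ` ▸ `hQ (Zχb r)` ▸ ✓`currency_h9`).  Everything by name; the proof is the certified chain.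
NOT HERE: h7∕h8 (px9 ✓`h7h8_member_peeled` ▸ `currency_h7h8_peeled` at the peel `p = 5`), ✓`patch_budget_v2`, the resource feeds and the wrapper to `hPatch` — next files.

HONEST SCOPE.  Composition by name of landed rows; nothing of `hPatch`∕(REC)∕hN06∕EX∕the crux is proved or claimed.

References: T. Bałaban, CMP **99** (1985) 389–434 [Balaban1985BackgroundPropagators] ((3.19)-(3.26) pp.393-395, (3.36)-(3.39) p.397, (3.100) pp.413-414);
CMP **98** (1985) 17–51 [Balaban1985Averaging] (pp.24-25); CMP **102** (1985) 277–309 [Balaban1985RegularSpaces] ((1.1)-(1.2) p.76).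
-/

set_option autoImplicit false

noncomputable section

open scoped InnerProductSpace Matrix.Norms.L2Operator BigOperators



namespace Summit.QuantumFields.YangMills.Theorems.Prop7DivRecoveryPatchRowsCore

open Literature.MathematicalPhysics.QuantumFieldTheory.Balaban1983to89
open Literature.MathematicalPhysics.QuantumFieldTheory.Balaban1983to89.T3ContinuumYM3Torus
open B11Eq103H1Complex (SiteL2K BondL2K)
open B10Eq27TorusAxialLog (transl unitsField toUField)
open B4Eq19LatticeOperators (Zd box unitVec)
open B7Eq78Linearization (conjR)
open B7Prop1Explicit (axialFn)
open B9TorusCalculus (torusT)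
open B9Eq39Adjoint (curl)
open B9Eq311L2Pairing (WL2)
open B5Eq118OneStroke (iterBlockOf)
open T3SectALandauChart (eta eta_pos bgUnits)
open Summit.QuantumFields.YangMills.Theorems.Prop7SymAvgGL (descendToGL)
open Summit.QuantumFields.YangMills.Theorems.Prop7QprimeCombL2 (QprimeCombL2)
open Summit.QuantumFields.YangMills.Theorems.Prop7DivRecoveryCurrencyH9 (currency_h9)
open T3PrintedRegularMinimiser (RegPr)
open T3PrintedRegularOrbits (sites_eq)
open T3LevelShift (bondShift)
open Summit.QuantumFields.YangMills.Theorems.Prop7SectET3Transport (periodsT3)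
open Summit.QuantumFields.YangMills.Theorems.Prop7SectET3HilbertLetters (W₂ frobEquiv toL2 toL2S DL2 DstarL2 covLapSite)
open Summit.QuantumFields.YangMills.Theorems.Prop7SectET3CombLetters (Qkc)
open Summit.QuantumFields.YangMills.Theorems.Prop7SPrint (basePt)
open Summit.QuantumFields.YangMills.Theorems.Prop7BoxLocalResidualMember (boxLocalResidual_member)
open Summit.QuantumFields.YangMills.Theorems.Prop7BoxLocalPotentialCutoffH1 (cutoffH1_member)
open Summit.QuantumFields.YangMills.Theorems.Prop7DivRecoveryPatchAlphaRows (patch_alpha_rows)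
open Summit.QuantumFields.YangMills.Theorems.Prop7DivRecoveryCutoffReadings (eta_mul_level patch_hDφ norm_sq_bondCutoff_le_norm_sq)
open Summit.QuantumFields.YangMills.Theorems.Prop7DivRecoveryAssemblyBudgetW4 (currency_h10)
open Summit.QuantumFields.YangMills.Theorems.Prop7Lane2BoxPlateauCutoff (exists_boxPlateauCutoff boxPlateau_eq_one_on_readSet boxPlateau_eq_zero_off_box
  exists_mem_box_bond_of_boxPlateau_ne_zero)
open Summit.QuantumFields.YangMills.Theorems.Prop7QkcInnerPatchRows (sum_fibre_Qkc_DL2_le_on_inner)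
open Summit.QuantumFields.YangMills.Theorems.Prop7Lane2SupportInChart (exists_mem_blockBox_of_dist_lt)
open Summit.QuantumFields.YangMills.Theorems.Prop7Lane2PatchCommutatorH1 (cellConst_of_support)
open Summit.QuantumFields.YangMills.Theorems.Prop7Lane2PatchCommutatorCubes (cycCube_closure mem_cycCube_filter localGrad_le_chartEnergy
  norm_sq_gradComm_le_of_le norm_sq_lapComm_le_of_le localEnergy_gradComm_le_of_le)
open Summit.QuantumFields.YangMills.Theorems.Prop7TiledCubeMemberH7H8 (sum_le_boxSum_of_chart)
open Summit.QuantumFields.YangMills.Theorems.Prop7LaplaceAFlatLetters (norm_sq_toL2S)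
open B4Eq19LatticeOperators (box_mono add_unitVec_mem_box)

set_option maxHeartbeats 400000 in
-- hb: the 17-conjunct existential over the eleven rows; `subst` + the final anonymous-constructor unification are whnf-heavy
/-- ★★★ **[I-9] PATCHES1 CORE — ONE PATCH OF THE MEMBER, EVERY PER-PATCH ROW BUT h7∕h8, BY NAME.**  See the module docstring for the inputs and the seventeen conjuncts
((S1b), (0), `hloc`, `hDφ`, h1, h2, h3, h4, h5, h6, h11, h10, h9 in budget currency). [cite: Balaban1985BackgroundPropagators, (3.19)-(3.26) pp.393-395, (3.100) pp.413-414] -/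
theorem patch_rows_core (F : T3Family) (n K s : ℕ) (hnK : n < K) (c₀ cB : ℝ) [hc0 : Fact (0 < c₀)] [Fact (0 < cB)]
    (W : GaugeField (F.P K) 0 (Matrix.specialUnitaryGroup (Fin 2) ℂ))
    (C : Site (F.P K) (K - n)) (c : Site (F.P K) 0)
    (hc : ∀ κ : Fin 3, c κ = (((C κ).val * F.L ^ (K - n) : ℕ) : ZMod ((F.P K).sitesPerDir 0)))
    (z : Zd (F.P K).d) (R : ℤ)
    (hz : z = fun κ : Fin (F.P K).d => ((F.L ^ (K - n) : ℕ) : ℤ) *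
          (((((c κ).val : ℕ) : ℤ) - ((((basePt F n K) κ).val : ℕ) : ℤ)) / ((F.L ^ (K - n) : ℕ) : ℤ)) + (((F.L ^ (K - n) : ℕ) : ℤ) - 1) / 2)
    (hRdef : R = (2 * ((F.L ^ s : ℕ) : ℤ) + 1) * ((F.L ^ (K - n) : ℕ) : ℤ) + (((F.L ^ (K - n) : ℕ) : ℤ) - 1) / 2)
    (hR : 0 ≤ R) (hR1 : 1 ≤ R) (hRN : 2 * R + 1 ≤ ((F.P K).sitesPerDir 0 : ℤ))
    (hRf : (R : ℝ) ≤ 4 * (F.L : ℝ) ^ s * (F.L : ℝ) ^ (K - n)) (hinj : Set.InjOn (transl (basePt F n K)) ↑(box z R))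
    (V : Zd (F.P K).d → Fin (F.P K).d → (Matrix (Fin 2) (Fin 2) ℂ)ˣ) (hV : ∀ w μ, V w μ = unitsField (toUField W) ⟨transl (basePt F n K) w, μ⟩)
    {α A e : ℝ} (hα : 0 ≤ α) (hαe : α ≤ A * e * eta F n K ^ 2)
    (he0 : 0 < e) (hw9 : 10 ^ 9 * (F.L : ℝ) ^ 3 * e ≤ 1) (hreg : RegPr F n K e W)
    (hP : B8Lemma1NonAbelian.PlaqSmall V (fun i => z i - R) (fun i => z i + R) α)
    (hw : 64 * ((F.P K).d : ℝ) ^ 3 * 2 * R ^ 3 * (2 * R + 1) * α ^ 2 ≤ 1)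
    (hw4 : 832 * ((F.P K).d : ℝ) ^ 3 * (2 * R + 1) ^ 2 * R ^ 2 * α ^ 2 ≤ 1)
    (y : BondL2K ℂ 3 (periodsT3 F K) c₀ W₂)
    {Cc Cu : ℝ} (hCc : 0 ≤ Cc) (hCu : 0 ≤ Cu)
    (hCurl : c₀ * ∑ w ∈ box z R, ∑ μ, ∑ ν, (if w + unitVec μ + unitVec ν ∈ box z R then
              ∑ j : Fin 2, ∑ k : Fin 2, ‖((toL2 F K c₀).symm y ⟨transl (basePt F n K) w, μ⟩
                + conjR (V w μ) ((toL2 F K c₀).symm y ⟨transl (basePt F n K) (w + unitVec μ), ν⟩)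
                - conjR (V w ν) ((toL2 F K c₀).symm y ⟨transl (basePt F n K) (w + unitVec ν), μ⟩)
                - (toL2 F K c₀).symm y ⟨transl (basePt F n K) w, ν⟩) j k‖ ^ 2 else 0)
          ≤ Cc * ((F.L : ℝ) ^ (K - n))⁻¹ ^ 2 * Cu)
    -- the family cutoff of the patch (ζ_g): ✓`exists_cutoffPackage_grid`'s per-centre rows VERBATIM at `c`
    (Z : SiteL2K ℂ 3 (periodsT3 F K) c₀ W₂ →ₗ[ℂ] SiteL2K ℂ 3 (periodsT3 F K) c₀ W₂) (ζ : Site (F.P K) 0 → ℝ)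
    (ZE : BondL2K ℂ 3 (periodsT3 F K) c₀ W₂ →ₗ[ℂ] BondL2K ℂ 3 (periodsT3 F K) c₀ W₂)
    (h01 : ∀ x, 0 ≤ ζ x ∧ ζ x ≤ 1)
    (hsuppζ : ∀ x : Site (F.P K) 0, ζ x ≠ 0 → ∀ κ : Fin 3, min (x κ - c κ).val (c κ - x κ).val < F.L ^ s * F.L ^ (K - n))
    (hstepζ : ∀ (x : Site (F.P K) 0) (μ : Fin 3), |ζ (x.shift μ) - ζ x| ≤ 3 / 2 / ((F.L : ℝ) ^ s * (F.L : ℝ) ^ (K - n)) ∧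
      |ζ (x.unshift μ) - ζ x| ≤ 3 / 2 / ((F.L : ℝ) ^ s * (F.L : ℝ) ^ (K - n)))
    (hsecζ : ∀ (x : Site (F.P K) 0) (μ : Fin 3), |ζ (x.shift μ) + ζ (x.unshift μ) - 2 * ζ x| ≤ 6 / ((F.L : ℝ) ^ s * (F.L : ℝ) ^ (K - n)) ^ 2)
    (hZ : ∀ φ x, (toL2S F K c₀).symm (Z φ) x = ζ x • (toL2S F K c₀).symm φ x)
    (hZE : ∀ f b, (toL2 F K c₀).symm (ZE f) b = ζ b.src • (toL2 F K c₀).symm f b)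
    (hew : e * ((F.L : ℝ) ^ s) ^ 2 ≤ 1) (hℓ4 : 4 ≤ F.L ^ s * F.L ^ (K - n))
    -- the peeled box mass dominates the transition cube's mass (px9 6c §4 ▸ ✓`sum_le_boxSum_of_chart`, p-generic re-cut ≈ 14:05Z), universal in the field
    {Φtbox : SiteL2K ℂ 3 (periodsT3 F K) c₀ W₂ → ℝ}
    (hboxS : ∀ φ' : SiteL2K ℂ 3 (periodsT3 F K) c₀ W₂,
      c₀ * ∑ x ∈ (Finset.univ.filter fun y : Site (F.P K) 0 => ∀ κ : Fin 3, min (y κ - c κ).val (c κ - y κ).val < F.L ^ s * F.L ^ (K - n) + 2),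
        ∑ j : Fin 2, ∑ k : Fin 2, ‖((toL2S F K c₀).symm φ' x) j k‖ ^ 2 ≤ Φtbox φ')
    (T : Finset (PBond (F.P K) 0))
    (hT : ∀ w ∈ box z R, ∀ μ, w + unitVec μ ∈ box z R → (⟨transl (basePt F n K) w, μ⟩ : PBond (F.P K) 0) ∈ T)
    -- (QH1)♮ AT THIS MEMBER (EX-displayed row `hQH1` instantiated; door functional written out), universal in `f`
    {Bq Bq' Bq'' : ℝ} (hBq : 0 ≤ Bq) (hBq' : 0 ≤ Bq') (hBq'' : 0 ≤ Bq'') (he1 : e ≤ 1)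
    (hQ : ∀ f : BondL2K ℂ 3 (periodsT3 F K) c₀ W₂,
      c₀ / cB * ((F.L : ℝ) ^ (K - n)) ^ 3 * ‖Qkc F n K hnK.le c₀ cB W f‖ ^ 2
        ≤ Bq * ‖f‖ ^ 2
          + Bq' * (c₀ * ((F.L : ℝ) ^ (K - n)) ^ 2 * (∑ x : Site (F.P K) 0, ∑ μ : Fin (F.P K).d, ∑ ν' : Fin (F.P K).d,
              (if μ < ν' then ∑ j : Fin 2, ∑ k : Fin 2,
                ‖(curl (torusT (F.P K) 0) (fun κ x => unitsField (toUField W) ⟨x, κ⟩) (fun κ x => (toL2 F K c₀).symm f ⟨x, κ⟩) μ ν' x) j k‖ ^ 2 else 0))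
              + ‖DstarL2 F n K c₀ W f‖ ^ 2)
          + Bq'' * e * ‖f‖ ^ 2)
    -- ✓`coarseGrad_rows_on_inner` AT THIS MEMBER (its `C3` obtained at the top of `patch_rows`), universal in the cutoff and the fields
    {C3 : ℝ}
    (hrow9 : ∀ (ζ' : Site (F.P K) 0 → ℝ) (Zb : BondL2K ℂ 3 (periodsT3 F K) c₀ W₂ →ₗ[ℂ] BondL2K ℂ 3 (periodsT3 F K) c₀ W₂),
      (∀ (f : BondL2K ℂ 3 (periodsT3 F K) c₀ W₂) (b : PBond (F.P K) 0), (toL2 F K c₀).symm (Zb f) b = ζ' b.src • (toL2 F K c₀).symm f b) →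
      ∀ (S' : Finset (PBond (F.P K) (K - n))),
        (∀ chat ∈ S', ∀ x : Site (F.P K) 0,
          (∀ κ : Fin (F.P K).d, min ((iterBlockOf (K - n) x) κ - chat.src κ).val (chat.src κ - (iterBlockOf (K - n) x) κ).val ≤ 2) → ζ' x = 1) →
        ∀ (φ' : SiteL2K ℂ 3 (periodsT3 F K) c₀ W₂) (y' r' : BondL2K ℂ 3 (periodsT3 F K) c₀ W₂),
          Zb (DL2 F n K c₀ W φ') = Zb y' - Zb r' →
          cB * ∑ c ∈ S', ‖conjR (descendToGL F n K hnK.le (bgUnits F K W) ((bondShift (sites_eq F n K hnK.le)).symm c))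
              (QprimeCombL2 F n K c₀ W φ' (c.src.shift c.dir)) - QprimeCombL2 F n K c₀ W φ' c.src‖ ^ 2
            ≤ 4 * (cB * ∑ c ∈ S', ‖WL2.equiv ℂ (fun _ : PBond (F.P n) 0 => cB) W₂
                  (Qkc F n K hnK.le c₀ cB W y') ((bondShift (sites_eq F n K hnK.le)).symm c)‖ ^ 2)
              + 4 * ‖Qkc F n K hnK.le c₀ cB W (Zb r')‖ ^ 2
              + C3 * e ^ 2 * ((((F.L : ℝ) ^ (K - n)) ^ 3)⁻¹ * ‖φ'‖ ^ 2))
    -- the peeled coarse-bond index set of h7∕h8∕h9 (px9 6b letter), with the plateau margin (px9 6c §1 ▸ w1 LINK)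
    (S : Finset (PBond (F.P K) (K - n)))
    (hSC : ∀ chat ∈ S, ∀ κ : Fin 3, min (chat.src κ - C κ).val (C κ - chat.src κ).val + 3 ≤ 2 * F.L ^ s) :
    ∃ (φ κs : SiteL2K ℂ 3 (periodsT3 F K) c₀ W₂) (r : BondL2K ℂ 3 (periodsT3 F K) c₀ W₂) (φZ : Zd (F.P K).d → Matrix (Fin 2) (Fin 2) ℂ),
      -- pass-through for (a′) h7∕h8: (S1b) and (0)
      (∀ w ∈ box z R, (toL2S F K c₀).symm φ (transl (basePt F n K) w) = (eta F n K) • φZ w) ∧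
      (∑ w ∈ box z R, conjR (axialFn V (fun i => z i - R) w) (φZ w) = 0) ∧
      -- hloc ∕ hDφ in Z-forms
      Z (DstarL2 F n K c₀ W y) = Z (covLapSite F n K c₀ W φ) + Z κs ∧
      ZE (DL2 F n K c₀ W φ) = ZE y - ZE r ∧
      -- h1 (Gφ_in ≤ N_T), h2, h3 (‖Z κs‖² ≤ K), h4
      c₀ * ∑ w ∈ box z R, ∑ μ, (if w + unitVec μ ∈ box z R then
          ∑ j : Fin 2, ∑ k : Fin 2, ‖(conjR (V w μ) (φZ (w + unitVec μ)) - φZ w) j k‖ ^ 2 else 0)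
        ≤ c₀ * ∑ b ∈ T, ‖(frobEquiv.symm ((toL2 F K c₀).symm y b) : W₂)‖ ^ 2 ∧
      ‖φ‖ ^ 2 ≤ 576 * ((F.L : ℝ) ^ s) ^ 2 * (c₀ * ∑ b ∈ T, ‖(frobEquiv.symm ((toL2 F K c₀).symm y b) : W₂)‖ ^ 2) ∧
      ‖Z κs‖ ^ 2 ≤ 13824 * A ^ 2 * ((F.L : ℝ) ^ s) ^ 2 * e ^ 2 * ‖r‖ ^ 2 ∧
      ‖r‖ ^ 2 ≤ 1944 * Cc * ((F.L : ℝ) ^ s) ^ 2 * Cu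
        + 20155392 * A ^ 2 * ((F.L : ℝ) ^ s) ^ 4 * e ^ 2 * (c₀ * ∑ b ∈ T, ‖(frobEquiv.symm ((toL2 F K c₀).symm y b) : W₂)‖ ^ 2) ∧
      -- h5, h6, h11 (B6-LOC)
      ‖covLapSite F n K c₀ W (Z φ) - Z (covLapSite F n K c₀ W φ)‖ ^ 2
        ≤ 972 * (((F.L : ℝ) ^ s)⁻¹ ^ 2 * (c₀ * ∑ b ∈ T, ‖(frobEquiv.symm ((toL2 F K c₀).symm y b) : W₂)‖ ^ 2) + ((F.L : ℝ) ^ s)⁻¹ ^ 4 * ‖φ‖ ^ 2) ∧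
      ‖DL2 F n K c₀ W (Z φ) - ZE (DL2 F n K c₀ W φ)‖ ^ 2 ≤ 27 / 4 * ((F.L : ℝ) ^ s)⁻¹ ^ 2 * Φtbox φ ∧
      c₀ * ((F.L : ℝ) ^ (K - n)) ^ 2 * (∑ x : Site (F.P K) 0, ∑ μ : Fin (F.P K).d, ∑ ν' : Fin (F.P K).d,
          (if μ < ν' then ∑ j : Fin 2, ∑ k : Fin 2,
            ‖(curl (torusT (F.P K) 0) (fun κ z => unitsField (toUField W) ⟨z, κ⟩)
              (fun κ z => (toL2 F K c₀).symm (DL2 F n K c₀ W (Z φ) - ZE (DL2 F n K c₀ W φ)) ⟨z, κ⟩) μ ν' x) j k‖ ^ 2 else 0))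
        + ‖DstarL2 F n K c₀ W (DL2 F n K c₀ W (Z φ) - ZE (DL2 F n K c₀ W φ))‖ ^ 2
        ≤ 4536 * (((F.L : ℝ) ^ s)⁻¹ ^ 2 * (c₀ * ∑ b ∈ T, ‖(frobEquiv.symm ((toL2 F K c₀).symm y b) : W₂)‖ ^ 2) + ((F.L : ℝ) ^ s)⁻¹ ^ 4 * ‖φ‖ ^ 2) ∧
      -- h10(ζ): the H¹ row of `ZE r` in currency
      c₀ * ((F.L : ℝ) ^ (K - n)) ^ 2 * (∑ x : Site (F.P K) 0, ∑ μ : Fin (F.P K).d, ∑ ν' : Fin (F.P K).d,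
          (if μ < ν' then ∑ j : Fin 2, ∑ k : Fin 2,
            ‖(curl (torusT (F.P K) 0) (fun κ x => unitsField (toUField W) ⟨x, κ⟩) (fun κ x => (toL2 F K c₀).symm (ZE r) ⟨x, κ⟩) μ ν' x) j k‖ ^ 2 else 0))
        + ‖DstarL2 F n K c₀ W (ZE r)‖ ^ 2
        ≤ (24 + 432 * A ^ 2 + 48 * (3 / 2) ^ 2) *
          (c₀ * ((F.L : ℝ) ^ (K - n)) ^ 2 * (∑ w ∈ box z R, ∑ μ : Fin (F.P K).d, ∑ ν' : Fin (F.P K).d,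
              (if μ < ν' then ∑ j : Fin 2, ∑ k : Fin 2,
                ‖(curl (torusT (F.P K) 0) (fun κ x => unitsField (toUField W) ⟨x, κ⟩) (fun κ x => (toL2 F K c₀).symm y ⟨x, κ⟩) μ ν' (transl (basePt F n K) w)) j k‖ ^ 2
              else 0))
            + e ^ 2 * ‖φ‖ ^ 2 + 13824 * A ^ 2 * ((F.L : ℝ) ^ s) ^ 2 * e ^ 2 * ‖r‖ ^ 2 + ((F.L : ℝ) ^ s)⁻¹ ^ 2 * ‖r‖ ^ 2) ∧
      -- h9 in budget currency (modulo the displayed (QH1)♮ row `hQ`)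
      c₀ * ((((F.L ^ (K - n)) ^ (F.P K).d : ℕ) : ℝ)) *
          (∑ c ∈ S, ‖conjR (descendToGL F n K hnK.le (bgUnits F K W) ((bondShift (sites_eq F n K hnK.le)).symm c))
              (QprimeCombL2 F n K c₀ W φ (c.src.shift c.dir)) - QprimeCombL2 F n K c₀ W φ c.src‖ ^ 2)
        ≤ 4 * (c₀ / cB * ((F.L : ℝ) ^ (K - n)) ^ 3 * (cB * ∑ c ∈ S, ‖WL2.equiv ℂ (fun _ : PBond (F.P n) 0 => cB) W₂
              (Qkc F n K hnK.le c₀ cB W y) ((bondShift (sites_eq F n K hnK.le)).symm c)‖ ^ 2))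
          + (4 * (Bq + Bq'') + 4 * Bq' * (24 + 432 * A ^ 2 + 48 * (2 * (F.L : ℝ) ^ s) ^ 2) * ((F.L : ℝ) ^ s)⁻¹ ^ 2) * ‖r‖ ^ 2
          + 4 * Bq' * (24 + 432 * A ^ 2 + 48 * (2 * (F.L : ℝ) ^ s) ^ 2) *
            (c₀ * ((F.L : ℝ) ^ (K - n)) ^ 2 * (∑ w ∈ box z R, ∑ μ : Fin (F.P K).d, ∑ ν' : Fin (F.P K).d,
              (if μ < ν' then ∑ j : Fin 2, ∑ k : Fin 2,
                ‖(curl (torusT (F.P K) 0) (fun κ x => unitsField (toUField W) ⟨x, κ⟩) (fun κ x => (toL2 F K c₀).symm y ⟨x, κ⟩) μ ν' (transl (basePt F n K) w)) j k‖ ^ 2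
              else 0)))
          + 4 * Bq' * (24 + 432 * A ^ 2 + 48 * (2 * (F.L : ℝ) ^ s) ^ 2) * (13824 * A ^ 2 * ((F.L : ℝ) ^ s) ^ 2 * e ^ 2 * ‖r‖ ^ 2)
          + (4 * Bq' * (24 + 432 * A ^ 2 + 48 * (2 * (F.L : ℝ) ^ s) ^ 2) + C3 * (c₀ / cB)) * e ^ 2 * ‖φ‖ ^ 2 := by
  subst hz hRdef
  -- ### ★p1-style support rows of `ζ` from the package support row (px9 ✓`exists_mem_blockBox_of_dist_lt`)
  have hζ : ∀ x, ζ x ≠ 0 → ∃ w ∈ box (fun κ : Fin (F.P K).d => ((F.L ^ (K - n) : ℕ) : ℤ) *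
          (((((c κ).val : ℕ) : ℤ) - ((((basePt F n K) κ).val : ℕ) : ℤ)) / ((F.L ^ (K - n) : ℕ) : ℤ)) + (((F.L ^ (K - n) : ℕ) : ℤ) - 1) / 2)
        ((2 * ((F.L ^ s : ℕ) : ℤ) + 1) * ((F.L ^ (K - n) : ℕ) : ℤ) + (((F.L ^ (K - n) : ℕ) : ℤ) - 1) / 2 - 1), transl (basePt F n K) w = x := by
    intro x hx
    obtain ⟨w, hw, he⟩ := exists_mem_blockBox_of_dist_lt F n K s (basePt F n K) c x (F.L ^ s * F.L ^ (K - n)) (by rw [mul_assoc]; omega) (hsuppζ x hx)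
    exact ⟨w, box_mono _ (by omega) hw, he⟩
  have hξ : ∀ b : PBond (F.P K) 0, ζ b.src ≠ 0 → ∃ w ∈ box (fun κ : Fin (F.P K).d => ((F.L ^ (K - n) : ℕ) : ℤ) *
          (((((c κ).val : ℕ) : ℤ) - ((((basePt F n K) κ).val : ℕ) : ℤ)) / ((F.L ^ (K - n) : ℕ) : ℤ)) + (((F.L ^ (K - n) : ℕ) : ℤ) - 1) / 2)
        ((2 * ((F.L ^ s : ℕ) : ℤ) + 1) * ((F.L ^ (K - n) : ℕ) : ℤ) + (((F.L ^ (K - n) : ℕ) : ℤ) - 1) / 2), transl (basePt F n K) w = b.src ∧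
        w + unitVec b.dir ∈ box (fun κ : Fin (F.P K).d => ((F.L ^ (K - n) : ℕ) : ℤ) *
          (((((c κ).val : ℕ) : ℤ) - ((((basePt F n K) κ).val : ℕ) : ℤ)) / ((F.L ^ (K - n) : ℕ) : ℤ)) + (((F.L ^ (K - n) : ℕ) : ℤ) - 1) / 2)
        ((2 * ((F.L ^ s : ℕ) : ℤ) + 1) * ((F.L ^ (K - n) : ℕ) : ℤ) + (((F.L ^ (K - n) : ℕ) : ℤ) - 1) / 2) := by
    intro b hb
    obtain ⟨w, hw, he⟩ := exists_mem_blockBox_of_dist_lt F n K s (basePt F n K) c b.src (F.L ^ s * F.L ^ (K - n)) (by rw [mul_assoc]; omega) (hsuppζ b.src hb)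
    exact ⟨w, box_mono _ (by omega) hw, he, box_mono _ (by omega) (add_unitVec_mem_box hw b.dir)⟩
  have hζδ : ∀ (x : Site (F.P K) 0) (μ : Fin (F.P K).d), |ζ (x.shift μ) - ζ x| ≤ 3 / 2 / ((F.L : ℝ) ^ s * (F.L : ℝ) ^ (K - n)) :=
    fun x μ => (hstepζ x μ).1
  -- ### (B8-member) potentials of the patch: 13 conjuncts
  obtain ⟨φ, κs, r, φZ, m, hS1a, hS1b, hS2a, hS2b, hD, hloc, hL1, h1, h2, h3, -, h4, h0⟩ :=
    boxLocalResidual_member F n K c₀ W (basePt F n K) hR hRN V hV hα hP hw hw4 y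
  -- ### α-rows through the family cutoff
  obtain ⟨hlocZ, hDφ, hGN, hρN, hΦ, hρ, hK, hKl⟩ := patch_alpha_rows F K c₀ n s W (basePt F n K) _ _ hR1 hRf hinj V hα hαe y r φ κs φZ m
    hS2b hD hloc hL1 h1 h2 h3 h4 hCc hCu hCurl Z ζ hZ h01 hζ ZE hZE hξ T hT
  -- ### letters
  have hd : (F.P K).d = 3 := T3Family.P_d F K
  have hℓη : eta F n K * (F.L : ℝ) ^ (K - n) = 1 := eta_mul_level F K n
  have hL0 : 0 < F.L := by have := F.hL.2; omega
  have hℓ : 0 < (F.L : ℝ) ^ (K - n) := pow_pos (by exact_mod_cast hL0) _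
  have hR₀ : 0 < (F.L : ℝ) ^ s := pow_pos (by exact_mod_cast hL0) _
  have hK0 : 0 ≤ 13824 * A ^ 2 * ((F.L : ℝ) ^ s) ^ 2 * e ^ 2 * ‖r‖ ^ 2 := by positivity
  have hCuW : 0 ≤ c₀ * ((F.L : ℝ) ^ (K - n)) ^ 2 * (∑ w ∈ box (fun κ : Fin (F.P K).d => ((F.L ^ (K - n) : ℕ) : ℤ) *
          (((((c κ).val : ℕ) : ℤ) - ((((basePt F n K) κ).val : ℕ) : ℤ)) / ((F.L ^ (K - n) : ℕ) : ℤ)) + (((F.L ^ (K - n) : ℕ) : ℤ) - 1) / 2)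
        ((2 * ((F.L ^ s : ℕ) : ℤ) + 1) * ((F.L ^ (K - n) : ℕ) : ℤ) + (((F.L ^ (K - n) : ℕ) : ℤ) - 1) / 2), ∑ μ : Fin (F.P K).d, ∑ ν' : Fin (F.P K).d,
      (if μ < ν' then ∑ j : Fin 2, ∑ k : Fin 2,
        ‖(curl (torusT (F.P K) 0) (fun κ x => unitsField (toUField W) ⟨x, κ⟩) (fun κ x => (toL2 F K c₀).symm y ⟨x, κ⟩) μ ν' (transl (basePt F n K) w)) j k‖ ^ 2
      else 0)) := by
    refine mul_nonneg (mul_nonneg hc0.out.le (sq_nonneg _)) (Finset.sum_nonneg fun _ _ => Finset.sum_nonneg fun _ _ =>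
      Finset.sum_nonneg fun _ _ => ?_)
    split_ifs
    · exact Finset.sum_nonneg fun _ _ => Finset.sum_nonneg fun _ _ => sq_nonneg _
    · exact le_rfl
  -- ### h10(ζ): the family H¹ row in currency (Cδ = 3∕2)
  have hζ1 : ∀ x, |ζ x| ≤ 1 := fun x => abs_le.mpr ⟨by linarith [(h01 x).1], (h01 x).2⟩
  have hζs : ∀ x, (∀ w ∈ box (fun κ : Fin (F.P K).d => ((F.L ^ (K - n) : ℕ) : ℤ) *
          (((((c κ).val : ℕ) : ℤ) - ((((basePt F n K) κ).val : ℕ) : ℤ)) / ((F.L ^ (K - n) : ℕ) : ℤ)) + (((F.L ^ (K - n) : ℕ) : ℤ) - 1) / 2)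
        ((2 * ((F.L ^ s : ℕ) : ℤ) + 1) * ((F.L ^ (K - n) : ℕ) : ℤ) + (((F.L ^ (K - n) : ℕ) : ℤ) - 1) / 2 - 1), transl (basePt F n K) w ≠ x) → ζ x = 0 :=
    fun x hx => by
      by_contra h
      obtain ⟨w, hw', hwx⟩ := hζ x h
      exact hx w hw' hwx
  have hHζ := cutoffH1_member F n K c₀ W (basePt F n K) hRN V hV hα hP y φ κs r φZ m hS1a hS1b hS2a hS2b hD hloc hL1 ζ hζ1 hζδ hζs
    (ZE r) (hZE r)
  have hδ : 0 ≤ 3 / 2 / ((F.L : ℝ) ^ s * (F.L : ℝ) ^ (K - n)) := by positivity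
  have hδC : 3 / 2 / ((F.L : ℝ) ^ s * (F.L : ℝ) ^ (K - n)) ≤ 3 / 2 * ((F.L : ℝ) ^ s * (F.L : ℝ) ^ (K - n))⁻¹ := le_of_eq (div_eq_mul_inv _ _)
  have h10ζ := currency_h10 (d := (F.P K).d) hd hℓη hℓ hR₀ hα hαe hδ hδC (sq_nonneg ‖φ‖) (sq_nonneg ‖r‖) hCuW hK0 hKl hHζ
  -- ### the χ-PACKAGE of the patch (✓p721352)
  obtain ⟨χ, Zχs, Zχb, h01χ, hplatχ, hsuppχ, hstepχ, hZχs, hZχb⟩ := exists_boxPlateauCutoff F n K s hnK c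
  -- hDφ(χ): the local equation through the box-plateau cutoff
  have hDφχ : Zχb (DL2 F n K c₀ W φ) = Zχb y - Zχb r :=
    patch_hDφ F K c₀ n W Zχb (fun b => χ b.src) hZχb (basePt F n K) _ _
      (exists_mem_box_bond_of_boxPlateau_ne_zero F n K s C c hc hnK χ hsuppχ)
      (fun w μ => conjR (V w μ) (φZ (w + unitVec μ)) - φZ w) hS2b hD
  -- ### h10(χ): the H¹ row of `Zχb r` in currency (δ = 2∕ℓ, Cδ = 2L^s)
  have hHχ := cutoffH1_member F n K c₀ W (basePt F n K) hRN V hV hα hP y φ κs r φZ m hS1a hS1b hS2a hS2b hD hloc hL1 χ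
    (fun x => abs_le.mpr ⟨by linarith [(h01χ x).1], (h01χ x).2⟩) (fun x μ => (hstepχ x μ).1)
    (boxPlateau_eq_zero_off_box F n K s C c hc hnK χ hsuppχ) (Zχb r) (hZχb r)
  have hδχ : 0 ≤ 2 / (F.L : ℝ) ^ (K - n) := by positivity
  have hδCχ : 2 / (F.L : ℝ) ^ (K - n) ≤ 2 * (F.L : ℝ) ^ s * ((F.L : ℝ) ^ s * (F.L : ℝ) ^ (K - n))⁻¹ := by
    rw [mul_inv, ← mul_assoc, mul_assoc 2, mul_inv_cancel₀ hR₀.ne', mul_one, div_eq_mul_inv]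
  have h10χ := currency_h10 (d := (F.P K).d) hd hℓη hℓ hR₀ hα hαe hδχ hδCχ (sq_nonneg ‖φ‖) (sq_nonneg ‖r‖) hCuW hK0 hKl hHχ
  -- ### h9 (As-part): the inner-patch coarse-gradient row through χ on the peeled set
  have h9As := sum_fibre_Qkc_DL2_le_on_inner (cB := cB) F n K hnK.le he0 hw9 W hreg χ Zχb hZχb S
    (fun chat hchat x hx => boxPlateau_eq_one_on_readSet F n K s C c hc hnK.le χ hplatχ chat (hSC chat hchat) x hx) φ y r hDφχ
  -- ### h9 in budget currency: raw row ▸ (QH1)♮ at `Zχb r` ▸ h10(χ) ▸ ★`currency_h9`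
  have h9raw := hrow9 χ Zχb hZχb S
    (fun chat hchat x hx => boxPlateau_eq_one_on_readSet F n K s C c hc hnK.le χ hplatχ chat (hSC chat hchat) x hx) φ y r hDφχ
  have hρχ : ‖Zχb r‖ ^ 2 ≤ ‖r‖ ^ 2 := norm_sq_bondCutoff_le_norm_sq F K c₀ Zχb (fun b => χ b.src) hZχb (fun b => h01χ b.src) r
  have hcB : 0 < cB := Fact.out
  have hGc : c₀ * ((((F.L ^ (K - n)) ^ (F.P K).d : ℕ) : ℝ)) *
        (∑ c ∈ S, ‖conjR (descendToGL F n K hnK.le (bgUnits F K W) ((bondShift (sites_eq F n K hnK.le)).symm c))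
            (QprimeCombL2 F n K c₀ W φ (c.src.shift c.dir)) - QprimeCombL2 F n K c₀ W φ c.src‖ ^ 2)
      = c₀ / cB * ((F.L : ℝ) ^ (K - n)) ^ 3 *
        (cB * ∑ c ∈ S, ‖conjR (descendToGL F n K hnK.le (bgUnits F K W) ((bondShift (sites_eq F n K hnK.le)).symm c))
            (QprimeCombL2 F n K c₀ W φ (c.src.shift c.dir)) - QprimeCombL2 F n K c₀ W φ c.src‖ ^ 2) := by
    rw [hd]; push_cast; field_simp
  have h9 := currency_h9 (div_nonneg hc0.out.le hcB.le) (pow_pos hℓ 3) he1 hBq hBq' hBq'' (sq_nonneg ‖Zχb r‖) hρχ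
    h9raw (hQ (Zχb r)) h10χ hGc rfl
  -- ### h5∕h6∕h11: px11 (B6-LOC) sockets on the cyclic cubes `S6 := {dist < D+2}`, `S6' := {dist < D+4}`, `D = L^s·ℓ`
  set Scube : Finset (Site (F.P K) 0) :=
    Finset.univ.filter fun y : Site (F.P K) 0 => ∀ κ : Fin 3, min (y κ - c κ).val (c κ - y κ).val < F.L ^ s * F.L ^ (K - n) + 2 with hScube
  set Scube' : Finset (Site (F.P K) 0) :=
    Finset.univ.filter fun y : Site (F.P K) 0 => ∀ κ : Fin 3, min (y κ - c κ).val (c κ - y κ).val < F.L ^ s * F.L ^ (K - n) + 2 + 2 with hScube'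
  have hζS := cellConst_of_support F K ζ c hsuppζ Scube (fun x hx => (mem_cycCube_filter F K c _ x).mpr hx)
  have hSS' := cycCube_closure F K c (F.L ^ s * F.L ^ (K - n) + 2) Scube Scube'
    (fun x hx => (mem_cycCube_filter F K c _ x).mp hx) (fun x hx => (mem_cycCube_filter F K c _ x).mpr hx)
  -- chart points of the larger cube (radius `D + 4 ≤ 2D`), with their bonds, inside the record box
  have hS'chart : ∀ y ∈ Scube', ∀ μ : Fin (F.P K).d, ∃ w ∈ box (fun κ : Fin (F.P K).d => ((F.L ^ (K - n) : ℕ) : ℤ) *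
          (((((c κ).val : ℕ) : ℤ) - ((((basePt F n K) κ).val : ℕ) : ℤ)) / ((F.L ^ (K - n) : ℕ) : ℤ)) + (((F.L ^ (K - n) : ℕ) : ℤ) - 1) / 2)
        ((2 * ((F.L ^ s : ℕ) : ℤ) + 1) * ((F.L ^ (K - n) : ℕ) : ℤ) + (((F.L ^ (K - n) : ℕ) : ℤ) - 1) / 2),
        transl (basePt F n K) w = y ∧ w + unitVec μ ∈ box (fun κ : Fin (F.P K).d => ((F.L ^ (K - n) : ℕ) : ℤ) *
          (((((c κ).val : ℕ) : ℤ) - ((((basePt F n K) κ).val : ℕ) : ℤ)) / ((F.L ^ (K - n) : ℕ) : ℤ)) + (((F.L ^ (K - n) : ℕ) : ℤ) - 1) / 2)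
        ((2 * ((F.L ^ s : ℕ) : ℤ) + 1) * ((F.L ^ (K - n) : ℕ) : ℤ) + (((F.L ^ (K - n) : ℕ) : ℤ) - 1) / 2) := by
    intro y hy μ
    have hy' := (mem_cycCube_filter F K c _ y).mp hy
    obtain ⟨w, hw, he⟩ := exists_mem_blockBox_of_dist_lt F n K s (basePt F n K) c y (F.L ^ s * F.L ^ (K - n) + 2 + 2) (by rw [mul_assoc]; omega) hy'
    exact ⟨w, box_mono _ (by omega) hw, he, box_mono _ (by omega) (add_unitVec_mem_box hw μ)⟩
  -- the local gradient energy on `S6'` is paid by `Gφ_in ≤ N_T`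
  have hGloc := localGrad_le_chartEnergy F K c₀ ((toL2 F K c₀).symm (DL2 F n K c₀ W φ)) _ (transl (basePt F n K)) hinj
    (fun w μ => conjR (V w μ) (φZ (w + unitVec μ)) - φZ w) hD Scube' hS'chart
  have hGN' := hGloc.trans hGN
  -- the local masses on `S6`, `S6'` are at most `‖φ‖²`
  have hmass : ∀ S0 : Finset (Site (F.P K) 0), c₀ * ∑ x ∈ S0, ∑ j : Fin 2, ∑ k : Fin 2, ‖((toL2S F K c₀).symm φ x) j k‖ ^ 2 ≤ ‖φ‖ ^ 2 := by
    intro S0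
    have hφ : ‖φ‖ ^ 2 = c₀ * ∑ x : Site (F.P K) 0, ∑ j : Fin 2, ∑ k : Fin 2, ‖((toL2S F K c₀).symm φ x) j k‖ ^ 2 := by
      conv_lhs => rw [← (toL2S F K c₀).apply_symm_apply φ]
      exact norm_sq_toL2S (F := F) (K := K) (c₀ := c₀) _
    rw [hφ]
    exact mul_le_mul_of_nonneg_left (Finset.sum_le_univ_sum_of_nonneg fun x => Finset.sum_nonneg fun _ _ => Finset.sum_nonneg fun _ _ => sq_nonneg _)
      hc0.out.le
  have h6 := norm_sq_gradComm_le_of_le F K c₀ n W Z ZE ζ s hZ hZE Scube hstepζ hζS φ (hboxS φ)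
  have h5 := norm_sq_lapComm_le_of_le F K c₀ n W Z ζ s hZ Scube Scube' hstepζ hsecζ hζS hSS' φ hGN' (hmass Scube)
  have h11 := localEnergy_gradComm_le_of_le F K c₀ n W Z ZE ζ s he0 hreg hew hZ hZE Scube Scube' hstepζ hsecζ hζS hSS' φ hGN' (hmass Scube')
  exact ⟨φ, κs, r, φZ, hS1b, h0, hlocZ, hDφ, hGN, hΦ, hK, hρ, h5, h6, h11, h10ζ, h9⟩

end Summit.QuantumFields.YangMills.Theorems.Prop7DivRecoveryPatchRowsCore

end
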